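import Summits.MatrixMultiplication.MatrixMultiplication.Theorems.EdgePencilTetraSymmetry
import Summits.MatrixMultiplication.MatrixMultiplication.Theorems.EdgePencilExponentConstancy
import HarnessLib

/-!
# `[T(K₄)_m]` is the product of its SIX EPR pairs: `[T(K₄)_m] = Π_{v<w} [P^{vw}_m]`, the six pair-rates
# `p^{vw}_φ = log₂ φ[P^{vw}_2]` of a spectral point, `τ_φ = Σ_{v<w} p^{vw}_φ`, and their transport to the edge `01`

Support kernel for `stmt-MatrixMultiplication-26697` (`TetraExcessZero : ω(K₄) ≤ ω(2,1,2)`, route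
`TetrahedronCarving`; cut of record `closes (TetraExcessZero) (TetraPlusTwo) : ω = 2`, UNCHANGED; lineage
`decomp-mm-lens-6`, generation 44). No item is added or changed; no definition is introduced — the EPR pair on
parties `v, w` with flat legs elsewhere is the explicit tensor `P^{vw}_m := fun a : Fin 4 → Fin m => ind (a v = a w)`
(`P^{01}_m` is the `P_m` of `EdgePencilPairFactor`), and the six-fold product is the explicit nested `kron`.

WHY (generation 44 memo, prerequisite (iii) of the six-edge CALIBRATION `TROP(n,2) ⟹ ω(K₄) ≤ max(ψ, 24/(5+δ))`):
the calibration sums the six pair-rates of a `T(K₄)`-maximal point and uses `Σ_{v<w} p^{vw}_φ = τ_φ = ω(K₄)`.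

§28 THE SIX-FOLD FACTORISATION (`sixKron_eq_tetra_precomp`, `tetra_eq_sixKron_precomp`, `mk_tetra_eq_prod_pairs`,
`spectrum_tetra_eq_prod_pairs`): the graph tensor of `K₄` is, by construction (CVZ19 Ex. 1.1.2), the tensor
product of one EPR pair per edge; in coordinates `⊗_{v<w} P^{vw}_m = T(K₄)_m ∘ (drop_v)_v` (party `v` keeps the
three components of its edges, `vertexLabels`) and `T(K₄)_m = (⊗ P^{vw}_m) ∘ (pad_v)_v` (party `v` pads its label
triple with idle components) — two per-leg precompositions (`EdgePencilLegSymmetry.restricts_precompFamily`), so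
the CLASSES agree; hence `φ[T(K₄)_m] = Π_{v<w} φ[P^{vw}_m]` for every `φ ∈ X₄(F)`.

§29 TRANSPORT TO THE EDGE `01` (`swapWord_apply`, `exists_transport_pair`, `one_le_spectrum_pairAt`,
`logb_spectrum_tetra_two_eq_sum_pairs`): for `v ≠ w` the vertex permutation `σ = (0 v)(1 σ₀⁻¹w)` has
`σ 0 = v, σ 1 = w`, so `φ^σ ∈ X₄(F)` (`EdgePencilLegSymmetry`) satisfies `φ^σ[P^{01}_k] = φ[P^{vw}_k]` and
`φ^σ[T(K₄)_k] = φ[T(K₄)_k]` (`EdgePencilTetraSymmetry`) for all `k`; consequently `1 ≤ φ[P^{vw}_m]` and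
`τ_φ = log₂ φ[T(K₄)_2] = Σ_{v<w} log₂ φ[P^{vw}_2]`.

References: Christandl–Vrana–Zuiddam 2019, Ex. 1.1.2 [ChristandlVranaZuiddam2016]; Strassen 1988, §2
[Strassen1988]; Zuiddam 2018, §2.3 [Zuiddam2018]. No `sorry`, no new axiom, no instance, no notation, no definition.
-/

noncomputable section

set_option linter.dupNamespace false

open Finset Literature.Computability.AlgebraicComplexity
open Literature.Computability.AlgebraicComplexity.DTensor
open Summit.MatrixMultiplication.MatrixMultiplication.Theorems.TetrahedronTensor

namespace Summit.MatrixMultiplication.MatrixMultiplication.Theorems.EdgePencil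

/-! ## §28 The six-fold factorisation `[T(K₄)_m] = Π_{v<w} [P^{vw}_m]` -/

section SixFold

variable {F : Type*} [Field F]

/-- **`⊗_{v<w} P^{vw}_m = T(K₄)_m ∘ (drop_v)_v`**: the six-fold product of the pairs (legs indexed by 6-tuples of
labels, nested as `kron` nests them) is `T(K₄)_m` precomposed leg-wise with «party `v` keeps the labels of its
three edges» (`vertexLabels`). [cite: ChristandlVranaZuiddam2016, Ex. 1.1.2] -/
theorem sixKron_eq_tetra_precomp (m : ℕ) :
    kron (kron (kron (kron (kron
      (fun a : Fin 4 → Fin m => (ind (a 0 = a 1) : F)) (fun a : Fin 4 → Fin m => (ind (a 0 = a 2) : F)))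
      (fun a : Fin 4 → Fin m => (ind (a 0 = a 3) : F))) (fun a : Fin 4 → Fin m => (ind (a 1 = a 2) : F)))
      (fun a : Fin 4 → Fin m => (ind (a 1 = a 3) : F))) (fun a : Fin 4 → Fin m => (ind (a 2 = a 3) : F)) =
    fun i : Fin 4 → ((((Fin m × Fin m) × Fin m) × Fin m) × Fin m) × Fin m =>
      tetra F m (fun v => finFunctionFinEquiv
        (vertexLabels (![(i v).1.1.1.1.1, (i v).1.1.1.1.2, (i v).1.1.1.2, (i v).1.1.2, (i v).1.2, (i v).2] :
          Fin 6 → Fin m) v)) := by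
  funext i
  simp only [kron_apply, tetra, Equiv.symm_apply_apply, ind_mul_ind]
  have hc : consistent (fun v => vertexLabels
      (![(i v).1.1.1.1.1, (i v).1.1.1.1.2, (i v).1.1.1.2, (i v).1.1.2, (i v).1.2, (i v).2] : Fin 6 → Fin m) v) =
        true ↔
      (((((i 0).1.1.1.1.1 = (i 1).1.1.1.1.1 ∧ (i 0).1.1.1.1.2 = (i 2).1.1.1.1.2) ∧
        (i 0).1.1.1.2 = (i 3).1.1.1.2) ∧ (i 1).1.1.2 = (i 2).1.1.2) ∧ (i 1).1.2 = (i 3).1.2) ∧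
          (i 2).2 = (i 3).2 := by
    rw [consistent_iff]
    simp [vertexLabels, and_assoc]
  simp only [ind]
  exact (if_congr hc rfl rfl).symm

/-- **`T(K₄)_m = (⊗_{v<w} P^{vw}_m) ∘ (pad_v)_v`**: `T(K₄)_m` is the six-fold product precomposed leg-wise with
«party `v` pads its label triple `L` to a 6-tuple» (edge `vw` gets `L (slot_v w)`, idle edges get `L 0`).
[cite: ChristandlVranaZuiddam2016, Ex. 1.1.2] -/
theorem tetra_eq_sixKron_precomp (m : ℕ) :
    tetra F m = fun z : Fin 4 → Fin (m ^ 3) =>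
      kron (kron (kron (kron (kron
        (fun a : Fin 4 → Fin m => (ind (a 0 = a 1) : F)) (fun a : Fin 4 → Fin m => (ind (a 0 = a 2) : F)))
        (fun a : Fin 4 → Fin m => (ind (a 0 = a 3) : F))) (fun a : Fin 4 → Fin m => (ind (a 1 = a 2) : F)))
        (fun a : Fin 4 → Fin m => (ind (a 1 = a 3) : F))) (fun a : Fin 4 → Fin m => (ind (a 2 = a 3) : F))
      (fun v => (![(((((lab (z v) 0, lab (z v) 1), lab (z v) 2), lab (z v) 0), lab (z v) 0), lab (z v) 0),
                  (((((lab (z v) 0, lab (z v) 0), lab (z v) 0), lab (z v) 1), lab (z v) 2), lab (z v) 0),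
                  (((((lab (z v) 0, lab (z v) 0), lab (z v) 0), lab (z v) 1), lab (z v) 0), lab (z v) 2),
                  (((((lab (z v) 0, lab (z v) 0), lab (z v) 0), lab (z v) 0), lab (z v) 1), lab (z v) 2)] :
        Fin 4 → ((((Fin m × Fin m) × Fin m) × Fin m) × Fin m) × Fin m) v) := by
  funext z
  simp only [kron_apply, tetra, ind_mul_ind, Matrix.cons_val_zero, Matrix.cons_val_one]
  have hc : consistent (fun v => (finFunctionFinEquiv.symm (z v) : Fin 3 → Fin m)) = true ↔
      ((((lab (z 0) 0 = lab (z 1) 0 ∧ lab (z 0) 1 = lab (z 2) 0) ∧ lab (z 0) 2 = lab (z 3) 0) ∧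
        lab (z 1) 1 = lab (z 2) 1) ∧ lab (z 1) 2 = lab (z 3) 1) ∧ lab (z 2) 2 = lab (z 3) 2 := by
    rw [consistent_iff]
    simp [lab, and_assoc]
  simp only [ind]
  refine (if_congr hc rfl rfl).trans ?_
  congr 1

/-- **THE SIX-FOLD FACTORISATION** `[T(K₄)_m] = [P^{01}_m]·[P^{02}_m]·[P^{03}_m]·[P^{12}_m]·[P^{13}_m]·[P^{23}_m]`
in `T₄(F)`. [cite: ChristandlVranaZuiddam2016, Ex. 1.1.2] -/
theorem mk_tetra_eq_prod_pairs (m : ℕ) :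
    DTensorClass.mk (tetra F m) =
      DTensorClass.mk (fun a : Fin 4 → Fin m => (ind (a 0 = a 1) : F)) *
        DTensorClass.mk (fun a : Fin 4 → Fin m => (ind (a 0 = a 2) : F)) *
        DTensorClass.mk (fun a : Fin 4 → Fin m => (ind (a 0 = a 3) : F)) *
        DTensorClass.mk (fun a : Fin 4 → Fin m => (ind (a 1 = a 2) : F)) *
        DTensorClass.mk (fun a : Fin 4 → Fin m => (ind (a 1 = a 3) : F)) *
        DTensorClass.mk (fun a : Fin 4 → Fin m => (ind (a 2 = a 3) : F)) := by
  rw [DTensorClass.mk_mul_mk, DTensorClass.mk_mul_mk, DTensorClass.mk_mul_mk, DTensorClass.mk_mul_mk,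
    DTensorClass.mk_mul_mk]
  symm
  refine DTensorClass.mk_eq_mk ?_ ?_
  · -- `T(K₄)_m ≥ ⊗ P`: `⊗ P = T ∘ drop`
    have h := restricts_precompFamily (K := F)
      (fun (v : Fin 4) (y : ((((Fin m × Fin m) × Fin m) × Fin m) × Fin m) × Fin m) => finFunctionFinEquiv
        (vertexLabels (![y.1.1.1.1.1, y.1.1.1.1.2, y.1.1.1.2, y.1.1.2, y.1.2, y.2] : Fin 6 → Fin m) v))
      (tetra F m)
    rw [sixKron_eq_tetra_precomp]
    exact h
  · -- `⊗ P ≥ T(K₄)_m`: `T = (⊗ P) ∘ pad`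
    have h := restricts_precompFamily (K := F)
      (fun (v : Fin 4) (x : Fin (m ^ 3)) =>
        (![(((((lab x 0, lab x 1), lab x 2), lab x 0), lab x 0), lab x 0),
           (((((lab x 0, lab x 0), lab x 0), lab x 1), lab x 2), lab x 0),
           (((((lab x 0, lab x 0), lab x 0), lab x 1), lab x 0), lab x 2),
           (((((lab x 0, lab x 0), lab x 0), lab x 0), lab x 1), lab x 2)] :
          Fin 4 → ((((Fin m × Fin m) × Fin m) × Fin m) × Fin m) × Fin m) v)
      (kron (kron (kron (kron (kron
        (fun a : Fin 4 → Fin m => (ind (a 0 = a 1) : F)) (fun a : Fin 4 → Fin m => (ind (a 0 = a 2) : F)))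
        (fun a : Fin 4 → Fin m => (ind (a 0 = a 3) : F))) (fun a : Fin 4 → Fin m => (ind (a 1 = a 2) : F)))
        (fun a : Fin 4 → Fin m => (ind (a 1 = a 3) : F))) (fun a : Fin 4 → Fin m => (ind (a 2 = a 3) : F)))
    rw [tetra_eq_sixKron_precomp]
    exact h

/-- **`φ[T(K₄)_m] = Π_{v<w} φ[P^{vw}_m]`** for every `φ ∈ X₄(F)`. [cite: Strassen1988, §2] -/
theorem spectrum_tetra_eq_prod_pairs {φ : DTensorClass F 4 → ℝ}
    (hφ : φ ∈ DTensorClass.asymptoticSpectrumDTensors F 2) (m : ℕ) :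
    φ (DTensorClass.mk (tetra F m)) =
      φ (DTensorClass.mk (fun a : Fin 4 → Fin m => (ind (a 0 = a 1) : F))) *
        φ (DTensorClass.mk (fun a : Fin 4 → Fin m => (ind (a 0 = a 2) : F))) *
        φ (DTensorClass.mk (fun a : Fin 4 → Fin m => (ind (a 0 = a 3) : F))) *
        φ (DTensorClass.mk (fun a : Fin 4 → Fin m => (ind (a 1 = a 2) : F))) *
        φ (DTensorClass.mk (fun a : Fin 4 → Fin m => (ind (a 1 = a 3) : F))) *
        φ (DTensorClass.mk (fun a : Fin 4 → Fin m => (ind (a 2 = a 3) : F))) := by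
  have hmul := (DTensorClass.mem_asymptoticSpectrumDTensors_iff.1 hφ).map_mul
  rw [mk_tetra_eq_prod_pairs, hmul, hmul, hmul, hmul, hmul]

end SixFold

/-! ## §29 Transport of each pair to the edge `01` -/

section Transport

variable (F : Type) [Field F]

/-- The vertex permutation `σ_{vw} = (0 v)·(1 ((0 v) w))` sends `0 ↦ v` and `1 ↦ w` (`v ≠ w`). [folklore] -/
theorem swapWord_apply : ∀ v w : Fin 4, v ≠ w →
    (Equiv.swap 0 v * Equiv.swap 1 (Equiv.swap 0 v w)) 0 = v ∧
      (Equiv.swap 0 v * Equiv.swap 1 (Equiv.swap 0 v w)) 1 = w := by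
  decide

/-- **TRANSPORT**: for parties `v ≠ w` and `φ ∈ X₄(F)` there is `φ' ∈ X₄(F)` (`φ' = φ^{σ_{vw}}`) with the same
values on every `T(K₄)_k` and with `φ'[P^{01}_k] = φ[P^{vw}_k]` for all `k`. [cite: Strassen1988, §2] -/
theorem exists_transport_pair (v w : Fin 4) (hvw : v ≠ w) {φ : DTensorClass F 4 → ℝ}
    (hφ : φ ∈ DTensorClass.asymptoticSpectrumDTensors F 2) :
    ∃ φ' ∈ DTensorClass.asymptoticSpectrumDTensors F 2,
      (∀ k : ℕ, φ' (DTensorClass.mk (tetra F k)) = φ (DTensorClass.mk (tetra F k))) ∧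
      ∀ k : ℕ, φ' (DTensorClass.mk (fun a : Fin 4 → Fin k => (ind (a 0 = a 1) : F))) =
        φ (DTensorClass.mk (fun a : Fin 4 → Fin k => (ind (a v = a w) : F))) := by
  obtain ⟨h0, h1⟩ := swapWord_apply v w hvw
  obtain ⟨φ', hφ', hφ'eq, hφ'T⟩ :=
    exists_spectrum_legPerm_tetra F (Equiv.swap 0 v * Equiv.swap 1 (Equiv.swap 0 v w)) hφ
  refine ⟨φ', hφ', hφ'T, fun k => ?_⟩
  rw [hφ'eq k]
  simp only [h0, h1]

/-- **`1 ≤ φ[P^{vw}_m]`** (`v ≠ w`, `1 ≤ m`). [cite: Zuiddam2018, Def. 2.11] -/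
theorem one_le_spectrum_pairAt (v w : Fin 4) (hvw : v ≠ w) {m : ℕ} (hm : 1 ≤ m) {φ : DTensorClass F 4 → ℝ}
    (hφ : φ ∈ DTensorClass.asymptoticSpectrumDTensors F 2) :
    1 ≤ φ (DTensorClass.mk (fun a : Fin 4 → Fin m => (ind (a v = a w) : F))) := by
  obtain ⟨φ', hφ', -, hP⟩ := exists_transport_pair F v w hvw hφ
  rw [← hP m]
  exact one_le_spectrum_pair (F := F) hm hφ'

/-- **`p^{vw}_φ ∈ [0,1]`** is the pair-rate of the transported point: `log₂ φ[P^{vw}_2] = p_{φ'}` for some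
`φ' ∈ X₄(F)` agreeing with `φ` on every `T(K₄)_k`. [cite: Zuiddam2018, Def. 2.11] -/
theorem pairRateAt_mem (v w : Fin 4) (hvw : v ≠ w) {φ : DTensorClass F 4 → ℝ}
    (hφ : φ ∈ DTensorClass.asymptoticSpectrumDTensors F 2) :
    0 ≤ Real.logb 2 (φ (DTensorClass.mk (fun a : Fin 4 → Fin 2 => (ind (a v = a w) : F)))) ∧
      Real.logb 2 (φ (DTensorClass.mk (fun a : Fin 4 → Fin 2 => (ind (a v = a w) : F)))) ≤ 1 := by
  obtain ⟨φ', hφ', -, hP⟩ := exists_transport_pair F v w hvw hφ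
  rw [← hP 2]
  exact coord_pair_mem hφ'

/-- **`τ_φ = Σ_{v<w} p^{vw}_φ`**: `log₂ φ[T(K₄)_2]` is the sum of the six pair-rates. [cite: ChristandlVranaZuiddam2016, Ex. 1.1.2] -/
theorem logb_spectrum_tetra_two_eq_sum_pairs {φ : DTensorClass F 4 → ℝ}
    (hφ : φ ∈ DTensorClass.asymptoticSpectrumDTensors F 2) :
    Real.logb 2 (φ (DTensorClass.mk (tetra F 2))) =
      Real.logb 2 (φ (DTensorClass.mk (fun a : Fin 4 → Fin 2 => (ind (a 0 = a 1) : F)))) +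
        Real.logb 2 (φ (DTensorClass.mk (fun a : Fin 4 → Fin 2 => (ind (a 0 = a 2) : F)))) +
        Real.logb 2 (φ (DTensorClass.mk (fun a : Fin 4 → Fin 2 => (ind (a 0 = a 3) : F)))) +
        Real.logb 2 (φ (DTensorClass.mk (fun a : Fin 4 → Fin 2 => (ind (a 1 = a 2) : F)))) +
        Real.logb 2 (φ (DTensorClass.mk (fun a : Fin 4 → Fin 2 => (ind (a 1 = a 3) : F)))) +
        Real.logb 2 (φ (DTensorClass.mk (fun a : Fin 4 → Fin 2 => (ind (a 2 = a 3) : F)))) := by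
  have h01 := one_le_spectrum_pairAt F 0 1 (by decide) (by norm_num : 1 ≤ 2) hφ
  have h02 := one_le_spectrum_pairAt F 0 2 (by decide) (by norm_num : 1 ≤ 2) hφ
  have h03 := one_le_spectrum_pairAt F 0 3 (by decide) (by norm_num : 1 ≤ 2) hφ
  have h12 := one_le_spectrum_pairAt F 1 2 (by decide) (by norm_num : 1 ≤ 2) hφ
  have h13 := one_le_spectrum_pairAt F 1 3 (by decide) (by norm_num : 1 ≤ 2) hφ
  have h23 := one_le_spectrum_pairAt F 2 3 (by decide) (by norm_num : 1 ≤ 2) hφ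
  rw [spectrum_tetra_eq_prod_pairs hφ 2, Real.logb_mul (by positivity) (by positivity),
    Real.logb_mul (by positivity) (by positivity), Real.logb_mul (by positivity) (by positivity),
    Real.logb_mul (by positivity) (by positivity), Real.logb_mul (by positivity) (by positivity)]

end Transport

end Summit.MatrixMultiplication.MatrixMultiplication.Theorems.EdgePencil

end
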